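import Summits.KontsevichZagierPeriods.KontsevichZagierPeriods.Theorems.OctahedralSymmetryOctahedralSpanAllWeightsStubWeightFourRefCert

/-!
# Crux `OctahedralSpanAllWeights` (stmt-KontsevichZagierPeriods-9659), line `Sketch`:
# row certificates with computed partial sums (helper for stub `stub_weight_five`)

The referenced certificates `RCert` of `…StubWeightFourRefCert` express `[W] − Σ y_V [V] − Σ z_U [U]`
(`V` two-letter, `U` certified earlier) as ONE combination `Σ x_g vec(g)` of generator expansions. In
the entangled bottom layers of weight `5` (unit words with few letters `2`) such a combination has
hundreds of generators and tens of thousands of expansion terms — more than one kernel decision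
comfortably replays. This file adds ROW tables in which a fat certificate is fed to the kernel in
slices: an *auxiliary row* names a slice `Σ_{g ∈ slice} x_g vec(g)` (plus cited earlier auxiliary
rows), and the checker itself COMPUTES its collected value (`FVec5.collect`, the radix pass of the
zero test, rebuilding the words) and keeps it for citation (index `0` = most recent); a *word row*
then certifies `[W] − Σ y_V [V] − Σ z_U [U] − Σ a_i r_i = Σ x_g vec(g)` with cited rows `r_i`.
Auxiliary rows need no zero test: their value is in `rel ⊔ twoSpan w` by construction.
* `FVec5.collectP`, `FVec5.collect` and `eval_collect` (collection of like terms preserves `eval`);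
* `XCert` (optional word, `nf`, `refs`, cited `rows`, `gens`), `XCert.rhs`, checker `XCert.ok`,
  soundness `XCert.sound_word` / `XCert.rhs_mem`;
* `xtableOk w earlier erows T` threading the certified words AND the auxiliary values,
  `XCert.wordsAfter`, `XCert.rowsAfter`, and the registered helper stub `xtable_sound`;
* the `ℤ`-scaled row format `ZXCert` / `ZXCert.toXCert` of the weight-5 tables.
Everything is generic in `w`; `twoLetterNormalForm_of_words` (RefCert) concludes from the word list.

Sources: J. Zhao, Doc. Math. 15 (2010), §2, §5; J. Zhao, C. R. Acad. Sci. Paris 346 (2008), §4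
(the relation families); reflection set-up of `…StubWeightTwo` / `…StubWeightFourRefCert`.
-/

namespace Summit.KontsevichZagierPeriods.OctahedralSymmetry.OctaSpan

open Literature.NumberTheory.Transcendental Literature.NumberTheory.Transcendental.LevelFour
open FVec5

namespace FVec5

/-- **Radix collection of like terms** with fuel `n`, the words being rebuilt after the prefix
`pre` (same bucketing as `zeroTest`; at fuel `0` the remaining entries are kept as they are).
[folklore] -/
def collectP : ℕ → List (Fin 5) → FVec5 → FVec5
  | 0, pre, v => v.map fun p => (pre ++ p.1, p.2)
  | n + 1, pre, v =>
      (if constCoeff v = 0 then [] else [(pre, constCoeff v)]) ++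
        (collectP n (pre ++ [0]) (tails 0 v) ++ (collectP n (pre ++ [1]) (tails 1 v) ++
          (collectP n (pre ++ [2]) (tails 2 v) ++ (collectP n (pre ++ [3]) (tails 3 v) ++
            collectP n (pre ++ [4]) (tails 4 v)))))

/-- Collection preserves the (prefix-generalised) realisation. [folklore] -/
theorem eval_collectP : ∀ (n : ℕ) (pre : List (Fin 5)) (v : FVec5),
    eval (collectP n pre v) = evalP pre v
  | 0, pre, v => by
    simp only [collectP, eval, evalP, List.map_map, Function.comp_def]
  | n + 1, pre, v => by
    rw [evalP_split pre v, Fin.sum_univ_five, collectP]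
    simp only [eval_append, eval_collectP n]
    split_ifs with h
    · simp only [h, zero_smul, zero_add, eval, List.map_nil, List.sum_nil]
      abel
    · simp only [eval, List.map_cons, List.map_nil, List.sum_cons, List.sum_nil, add_zero]
      abel

/-- **Collection of like terms** (fuel `n = w + 1` for words of length `≤ w`). [folklore] -/
def collect (n : ℕ) (v : FVec5) : FVec5 := collectP n [] v

/-- Collection preserves the realisation. [folklore] -/
theorem eval_collect (n : ℕ) (v : FVec5) : eval (collect n v) = eval v := by
  rw [collect, eval_collectP]
  simp [evalP, eval]

end FVec5

/-- A ROW of a row table: a *word row* (`word = some W`) certifies `W`; an *auxiliary row*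
(`word = none`) names the partial sum `Σ nf + Σ refs + Σ a_i r_i + Σ x_g vec(g)` for later citation.
`rows` cites earlier auxiliary values by index (`0` = the most recent). [folklore] -/
structure XCert where
  /-- `some W`: a word row certifying `W`; `none`: an auxiliary row -/
  word : Option (List (Fin 5))
  /-- two-letter words with coefficients -/
  nf : FVec5
  /-- earlier-certified words with coefficients -/
  refs : FVec5
  /-- cited earlier auxiliary rows: (index, coefficient), index `0` = the most recent -/
  rows : List (ℕ × ℚ)
  /-- generator terms with coefficients -/
  gens : List (GenTerm × ℚ)

namespace XCert

/-- The right-hand side `Σ nf + Σ refs + Σ a_i r_i + Σ x_g vec(g)` of a row, expanded against the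
list `erows` of earlier auxiliary values (an out-of-range index cites the empty vector). [folklore] -/
def rhs (c : XCert) (erows : List FVec5) : FVec5 :=
  c.nf ++ c.refs ++ (c.rows.flatMap fun p => smul p.2 (erows.getD p.1 [])) ++
    c.gens.flatMap fun p => smul p.2 p.1.vecF

/-- The data checks of a row: `nf` words are two-letter words of length `w`, `refs` words lie in
`earlier`, generator terms pass `GenTerm.ok`. [folklore] -/
def dataOk (w : ℕ) (earlier : List (List (Fin 5))) (c : XCert) : Bool :=
  c.nf.all (fun p => decide (p.1.length = w ∧ ∀ a ∈ p.1, a = 1 ∨ a = 3)) &&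
    (c.refs.all (fun p => decide (p.1 ∈ earlier)) && c.gens.all (fun p => p.1.ok))

/-- **The row checker**: the data checks, and for a word row the radix zero test of
`[W] − rhs`. [folklore] -/
def ok (w : ℕ) (earlier : List (List (Fin 5))) (erows : List FVec5) (c : XCert) : Bool :=
  c.dataOk w earlier &&
    match c.word with
    | some W => zeroTest (w + 1) ((W, 1) :: smul (-1) (c.rhs erows))
    | none => true

/-- The right-hand side realises to the sum of its four parts. [folklore] -/
theorem eval_rhs (c : XCert) (erows : List FVec5) : eval (c.rhs erows) =
    eval c.nf + eval c.refs + (c.rows.map fun p => p.2 • eval (erows.getD p.1 [])).sum +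
      (c.gens.map fun p => p.2 • eval p.1.vecF).sum := by
  simp only [rhs, eval_append, eval_flatMap, eval_smul]

/-- **A checked right-hand side lies in `rel ⊔ twoSpan w`** if the cited words and auxiliary values
do. [folklore] -/
theorem rhs_mem (w : ℕ) (earlier : List (List (Fin 5))) (erows : List FVec5) (c : XCert)
    (h : c.dataOk w earlier = true) (hE : ∀ U ∈ earlier, sym U ∈ rel ⊔ twoSpan w)
    (hR : ∀ v ∈ erows, eval v ∈ rel ⊔ twoSpan w) : eval (c.rhs erows) ∈ rel ⊔ twoSpan w := by
  simp only [dataOk, Bool.and_eq_true, List.all_eq_true, decide_eq_true_eq] at h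
  obtain ⟨hnf, hrefs, hg⟩ := h
  rw [eval_rhs]
  refine add_mem (add_mem (add_mem ?_ ?_) ?_) ?_
  · refine Submodule.mem_sup_right (list_sum_mem fun x hx => ?_)
    obtain ⟨p, hp, rfl⟩ := List.mem_map.1 hx
    refine Submodule.smul_mem _ _ (Submodule.subset_span ⟨p.1, ?_, rfl⟩)
    exact Finset.mem_coe.2 ((mem_twoWords_iff w p.1).2 (hnf p hp))
  · refine list_sum_mem fun x hx => ?_
    obtain ⟨p, hp, rfl⟩ := List.mem_map.1 hx
    exact Submodule.smul_mem _ _ (hE p.1 (hrefs p hp))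
  · refine list_sum_mem fun x hx => ?_
    obtain ⟨p, hp, rfl⟩ := List.mem_map.1 hx
    refine Submodule.smul_mem _ _ ?_
    by_cases hi : p.1 < erows.length
    · rw [List.getD_eq_getElem _ _ hi]
      exact hR _ (List.getElem_mem hi)
    · rw [List.getD_eq_default _ _ (Nat.le_of_not_lt hi)]
      simp [eval]
  · refine Submodule.mem_sup_left (list_sum_mem fun x hx => ?_)
    obtain ⟨p, hp, rfl⟩ := List.mem_map.1 hx
    exact Submodule.smul_mem _ _ (mem_rel_of_isGen (GenTerm.isGen_eval p.1 (hg p hp)))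

/-- **Soundness of a word row**: an accepted word row puts its word in `rel ⊔ twoSpan w`.
[folklore] -/
theorem sound_word (w : ℕ) (earlier : List (List (Fin 5))) (erows : List FVec5) (c : XCert)
    (W : List (Fin 5)) (hW : c.word = some W) (h : c.ok w earlier erows = true)
    (hE : ∀ U ∈ earlier, sym U ∈ rel ⊔ twoSpan w) (hR : ∀ v ∈ erows, eval v ∈ rel ⊔ twoSpan w) :
    sym W ∈ rel ⊔ twoSpan w := by
  simp only [ok, hW, Bool.and_eq_true] at h
  obtain ⟨hd, hz⟩ := h
  have h0 := eval_eq_zero_of_zeroTest hz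
  rw [eval_cons, eval_smul, one_smul, neg_one_smul, ← sub_eq_add_neg, sub_eq_zero] at h0
  rw [h0]
  exact rhs_mem w earlier erows c hd hE hR

/-- The certified words after one row (a word row prepends its word). [folklore] -/
def wordsStep (c : XCert) (earlier : List (List (Fin 5))) : List (List (Fin 5)) :=
  match c.word with
  | some W => W :: earlier
  | none => earlier

/-- The auxiliary values after one row (an auxiliary row prepends the COLLECTED value of its
right-hand side, fuel `w + 1`). [folklore] -/
def rowsStep (w : ℕ) (c : XCert) (erows : List FVec5) : List FVec5 :=
  match c.word with
  | some _ => erows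
  | none => collect (w + 1) (c.rhs erows) :: erows

/-- The certified words after the table `T` on top of `earlier` (most recent first). [folklore] -/
def wordsAfter : List XCert → List (List (Fin 5)) → List (List (Fin 5))
  | [], earlier => earlier
  | c :: T, earlier => wordsAfter T (c.wordsStep earlier)

/-- The auxiliary values after the table `T` on top of (`earlier`-independent) `erows`. [folklore] -/
def rowsAfter (w : ℕ) : List XCert → List FVec5 → List FVec5
  | [], erows => erows
  | c :: T, erows => rowsAfter w T (c.rowsStep w erows)

end XCert

/-- **The row-table checker**: check the rows in order, threading the certified words and the
auxiliary values. [folklore] -/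
def xtableOk (w : ℕ) : List (List (Fin 5)) → List FVec5 → List XCert → Bool
  | _, _, [] => true
  | earlier, erows, c :: T =>
      c.ok w earlier erows && xtableOk w (c.wordsStep earlier) (c.rowsStep w erows) T

/-- **Soundness of a checked row table** (registered helper stub `xtable_sound`): if `xtableOk`
accepts `T` on top of words `earlier` and auxiliary values `erows` that realise into
`rel ⊔ twoSpan w`, then so do all words certified after `T` and all auxiliary values after `T`.
[folklore] -/
theorem xtable_sound (w : ℕ) (earlier : List (List (Fin 5))) (erows : List FVec5) (T : List XCert)
    (hT : xtableOk w earlier erows T = true) (hE : ∀ U ∈ earlier, sym U ∈ rel ⊔ twoSpan w)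
    (hR : ∀ v ∈ erows, eval v ∈ rel ⊔ twoSpan w) :
    (∀ U ∈ XCert.wordsAfter T earlier, sym U ∈ rel ⊔ twoSpan w) ∧
      ∀ v ∈ XCert.rowsAfter w T erows, eval v ∈ rel ⊔ twoSpan w := by
  induction T generalizing earlier erows with
  | nil => simpa [XCert.wordsAfter, XCert.rowsAfter] using ⟨hE, hR⟩
  | cons c T ih =>
    simp only [xtableOk, Bool.and_eq_true] at hT
    refine ih (c.wordsStep earlier) (c.rowsStep w erows) hT.2 (fun U hU => ?_) (fun v hv => ?_)
    · unfold XCert.wordsStep at hU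
      cases hcw : c.word with
      | none => rw [hcw] at hU; exact hE U hU
      | some W =>
        rw [hcw] at hU
        rcases List.mem_cons.1 hU with rfl | hU
        · exact XCert.sound_word w earlier erows c U hcw hT.1 hE hR
        · exact hE U hU
    · unfold XCert.rowsStep at hv
      cases hcw : c.word with
      | some W => rw [hcw] at hv; exact hR v hv
      | none =>
        rw [hcw] at hv
        rcases List.mem_cons.1 hv with rfl | hv
        · rw [eval_collect]
          have hd : c.dataOk w earlier = true := by
            have h1 := hT.1
            simp only [XCert.ok, hcw, Bool.and_true] at h1
            exact h1
          exact XCert.rhs_mem w earlier erows c hd hE hR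
        · exact hR v hv

/-- A `ℤ`-scaled row `⟨word?, den, nf, refs, rows, gens⟩`: one common denominator `den` for the
integer coefficients. [folklore] -/
structure ZXCert where
  /-- `some W` for a word row, `none` for an auxiliary row -/
  word : Option (List (Fin 5))
  /-- the common denominator -/
  den : ℕ
  /-- two-letter part, scaled by `den` -/
  nf : List (List (Fin 5) × ℤ)
  /-- references, scaled by `den` -/
  refs : List (List (Fin 5) × ℤ)
  /-- cited auxiliary rows, scaled by `den` -/
  rows : List (ℕ × ℤ)
  /-- generator terms, scaled by `den` -/
  gens : List (GenTerm × ℤ)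

/-- The row of a `ℤ`-scaled row (divide every coefficient by `den`). [folklore] -/
def ZXCert.toXCert (z : ZXCert) : XCert :=
  ⟨z.word, z.nf.map fun p => (p.1, (p.2 : ℚ) / z.den), z.refs.map fun p => (p.1, (p.2 : ℚ) / z.den),
    z.rows.map fun p => (p.1, (p.2 : ℚ) / z.den), z.gens.map fun p => (p.1, (p.2 : ℚ) / z.den)⟩

/-- Smoke test (kernel): `[2,2,2,2]` certified in two rows — an auxiliary row naming
`2 · dilGen [2,2,2,2]`, then the word row citing it (index `0`) with coefficient `1/2` next to the
sixteen two-letter words. [folklore] -/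
example : xtableOk 4 [] []
    [ZXCert.toXCert ⟨none, 1, [], [], [], [(.dil [2, 2, 2, 2], 2)]⟩,
     ZXCert.toXCert ⟨some [2, 2, 2, 2], 2,
        [([1, 1, 1, 1], 2), ([1, 1, 1, 3], 2), ([1, 1, 3, 1], 2), ([1, 1, 3, 3], 2), ([1, 3, 1, 1], 2),
         ([1, 3, 1, 3], 2), ([1, 3, 3, 1], 2), ([1, 3, 3, 3], 2), ([3, 1, 1, 1], 2), ([3, 1, 1, 3], 2),
         ([3, 1, 3, 1], 2), ([3, 1, 3, 3], 2), ([3, 3, 1, 1], 2), ([3, 3, 1, 3], 2), ([3, 3, 3, 1], 2),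
         ([3, 3, 3, 3], 2)], [], [(0, 1)], []⟩] = true := by
  decide +kernel

end Summit.KontsevichZagierPeriods.OctahedralSymmetry.OctaSpan
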